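import Mathlib
import Literature.Computability.AlgebraicComplexity.HessianRank

/-!
# Null subspaces through a non-degenerate zero are isotropic, hence half-dimensional

If a polynomial `f` vanishes on a linear subspace `W ∋ y` and the Hessian of `f` at `y` is
non-degenerate, then `2 · dim W ≤ #variables` (the a-priori "Lagrangian" bound of
Mignon–Ressayre / Landsberg–Manivel–Ressayre). Two steps:

* isotropy: for `w₁, w₂ ∈ W` the two-variable polynomial `f(y + s w₁ + t w₂)` vanishes at every
  point of `ℂ²`, hence is zero; the `(s, t)` entry of its Hessian at `0`, computed by the affine
  chain rule `hessianMatrix_aeval_C_add_linear`, is `w₁ᵀ · Hess f (y) · w₂`;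
* linear algebra: `W` lies in its own orthogonal for the non-degenerate bilinear form
  `Hess f (y)`, whose dimension is `#variables - dim W` (`LinearMap.BilinForm.finrank_orthogonal`).
-/

set_option linter.dupNamespace false

noncomputable section

open MvPolynomial Matrix
open Literature.Computability.AlgebraicComplexity

namespace Summit.ValiantsHypothesis.ValiantsHypothesis.Theorems.RefutationDegree

/-- **Isotropy.** If `f` vanishes on the linear subspace `W` and `y, w₁, w₂ ∈ W`, then
`w₁ᵀ · Hess f (y) · w₂ = 0`: the two-variable polynomial `f(y + s w₁ + t w₂)` vanishes
identically (`ℂ` is infinite), and the `(s, t)` entry of its Hessian at `0` is this pairing by the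
affine chain rule. -/
theorem dotProduct_hessianMatrix_mulVec_eq_zero_of_eval_eq_zero {σ : Type*} [Fintype σ]
    (f : MvPolynomial σ ℂ) (y : σ → ℂ) (W : Submodule ℂ (σ → ℂ)) (hyW : y ∈ W)
    (hW : ∀ w ∈ W, eval w f = 0) {w₁ w₂ : σ → ℂ} (h₁ : w₁ ∈ W) (h₂ : w₂ ∈ W) :
    w₁ ⬝ᵥ hessianMatrix f y *ᵥ w₂ = 0 := by
  set L : Matrix σ (Fin 2) ℂ := Matrix.of fun e v => ![w₁ e, w₂ e] v with hL
  let φ : σ → MvPolynomial (Fin 2) ℂ := fun t => C (y t) + ∑ v : Fin 2, C (L t v) * X v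
  -- the substituted polynomial vanishes at every point of `ℂ²`, hence is zero
  have hG : aeval φ f = 0 := by
    refine MvPolynomial.funext fun x => ?_
    rw [eval_aeval_eq_eval, map_zero]
    have hpt : (fun t => eval x (φ t)) = y + x 0 • w₁ + x 1 • w₂ := by
      ext t
      simp only [φ, hL, map_add, eval_C, map_mul, eval_X, Fin.sum_univ_two, of_apply,
        Matrix.cons_val_zero, Matrix.cons_val_one, Pi.add_apply, Pi.smul_apply, smul_eq_mul]
      ring
    rw [hpt]
    exact hW _ (W.add_mem (W.add_mem hyW (W.smul_mem _ h₁)) (W.smul_mem _ h₂))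
  have hH := hessianMatrix_aeval_C_add_linear y L f (0 : Fin 2 → ℂ)
  rw [hG, hessianMatrix_zero] at hH
  have hpt : (fun t => y t + ∑ v : Fin 2, L t v * (0 : Fin 2 → ℂ) v) = y := by
    ext t; simp
  rw [hpt] at hH
  have h01 := congr_fun (congr_fun hH 0) 1
  rw [Matrix.zero_apply, Matrix.mul_apply] at h01
  rw [dotProduct_mulVec]
  simp only [Matrix.mul_apply, transpose_apply, vecMul, dotProduct] at h01 ⊢
  rw [h01]
  refine Finset.sum_congr rfl fun q _ => ?_
  simp [hL]

/-- **Null subspaces through a non-degenerate zero are isotropic, hence half-dimensional.**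
If a polynomial `f` vanishes on a linear subspace `W ∋ y` and its Hessian at `y` is
non-degenerate, then `2 dim W ≤ #variables`: `W` is totally isotropic for the non-degenerate
symmetric bilinear form `Hess f (y)`, so `W ≤ W^⊥` and `dim W^⊥ = #variables - dim W`. -/
theorem stub_isotropic_of_null {σ : Type*} [Fintype σ] [DecidableEq σ] (f : MvPolynomial σ ℂ)
    (y : σ → ℂ) (hH : (hessianMatrix f y).det ≠ 0)
    (W : Submodule ℂ (σ → ℂ)) (hyW : y ∈ W) (hW : ∀ w ∈ W, eval w f = 0) :
    2 * Module.finrank ℂ W ≤ Fintype.card σ := by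
  set B : LinearMap.BilinForm ℂ (σ → ℂ) := Matrix.toBilin' (hessianMatrix f y) with hB
  have hnd : B.Nondegenerate :=
    LinearMap.BilinForm.nondegenerate_toBilin'_of_det_ne_zero' _ hH
  have hle : W ≤ B.orthogonal W := by
    intro w hw
    rw [LinearMap.BilinForm.mem_orthogonal_iff]
    intro w' hw'
    rw [hB, Matrix.toBilin'_apply']
    exact dotProduct_hessianMatrix_mulVec_eq_zero_of_eval_eq_zero f y W hyW hW hw' hw
  have h1 := Submodule.finrank_mono hle
  rw [LinearMap.BilinForm.finrank_orthogonal hnd W, Module.finrank_fintype_fun_eq_card] at h1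
  have h2 : Module.finrank ℂ W ≤ Module.finrank ℂ (σ → ℂ) := Submodule.finrank_le W
  rw [Module.finrank_fintype_fun_eq_card] at h2
  omega

end Summit.ValiantsHypothesis.ValiantsHypothesis.Theorems.RefutationDegree

end
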